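import Summits.BirchSwinnertonDyer.BirchSwinnertonDyer.Theorems.ManinLocalTwoThreeStevensShimuraExponentMazur
import HarnessLib

/-!
# The Shimura kernel EMBEDS in the rational torsion of Stevens' twin (fact-free), so `[Λ₀(f) : Λ₁(f)] ∈ {1,…,10,12,16}` ⟸ Mazur alone
(route `ManinLocalTwoThree`, crux C2 `ManinOddAtFour` stmt-BirchSwinnertonDyer-22967; cell bsd-f2-manin, prover seat p3 gen 21;
`--supports stmt-BirchSwinnertonDyer-22967`; sequel to `ManinLocalTwoThreeStevensShimuraExponentMazur.lean`)

For every `X₀(N)`-datum `D₀` of an elliptic `W₀/ℚ` (`f = D₀.f`, `Λ₀ = periodLattice f`, `Λ₁ = periodLatticeGamma1 f`):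

* §1 **`exists_shimuraKernelHom`** (fact-free): for an `X₁(N)`-datum `D₁` of `W₁` with `Λ(D₁.L) = Λ₁(f)` whose `Γ₀(N)`-periods uniformise
  to rational points (p2's `CuspValues.shimuraKernelRational`), the assignment `z ↦ (the rational point over π₁(z))` is an additive
  homomorphism `g : Λ₀(f) →+ W₁(ℚ)` with `g(z) ⊗ ℂ = π₁(z)`, `ker g = Λ₁(f) ∩ Λ₀(f)` and torsion values — THEOREM K's map `K′ = Λ₀/Λ₁ ↪ W₁(ℚ)_tors`
  (Vatsal 2005 Rem. 1.8) as a kernel object; `relIndex_eq_card_range`: `[Λ₀(f) : Λ₁(f)] = #g(Λ₀(f))`.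
* §2 **`relIndex_dvd_card_torsion_of_mazur`** / **`relIndex_mazurDivisor_of_mazur`** (⟸ `mazur_torsion` ALONE, no modularity):
  `[Λ₀(f) : Λ₁(f)]` divides `#W₁(ℚ)_tors ∈ {1,…,10,12} ∪ {4, 8, 12, 16}`, hence `1 ≤ [Λ₀(f) : Λ₁(f)]` and
  `[Λ₀(f) : Λ₁(f)] ∈ {1,…,10,12,16}` — the printed bound `#(E₀ ∩ Σ(N)) ≤ 16` kernel-checked modulo Mazur's theorem; with modularity
  (cyclicity) the sibling file sharpens this to `{1,…,10,12}` (`relIndex_mazurOrder_of_modularity`).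

HONEST FRAMING: §1 is unconditional and fact-free; §2 is CONDITIONAL on the statement-only printed fact `mazur_torsion` (Mazur 1977 Thm. 8).
Nothing here narrows C2/C3; Manin's conjecture and BSD are NOT proved.  No definitions, no sorry.
[cite: Mazur1977, Thm. (8)] [cite: Stevens1989, §2 (1.4), (2.8)] [cite: Vatsal2005, Rem. 1.8] [cite: LingOesterle1991, §1]
-/

set_option autoImplicit false
-- lint-debt: the directory name repeats the summit name (sibling precedent `ManinLocalTwoThreeStevensShimuraExponentMazur.lean`)
set_option linter.dupNamespace false

noncomputable section

open CongruenceSubgroup WeierstrassCurve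
open Literature.NumberTheory.EllipticCurves Literature.NumberTheory.EllipticCurves.ModularForms

namespace Summit.BirchSwinnertonDyer.BirchSwinnertonDyer.Theorems.ManinLocalTwoThree.StevensCurve

variable {N : ℕ} [NeZero N]

/-! ## §1 The Shimura kernel map `Λ₀(f) →+ W₁(ℚ)` (fact-free) -/

/-- **THEOREM K's map as a kernel object (fact-free).**  For an `X₁(N)`-datum `D₁` of `W₁` with `Λ(D₁.L) = Λ₁(f)` whose `Γ₀(N)`-periods
uniformise to rational points, there is an additive homomorphism `g : Λ₀(f) →+ W₁(ℚ)` with `g(z) ⊗ ℂ = π₁(z)`, kernel `Λ₁(f) ∩ Λ₀(f)` and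
torsion values (`φ(N)Λ₀ ⊆ Λ₁`). [cite: Stevens1989, §2 (1.4), (2.8)] [cite: Vatsal2005, Rem. 1.8] -/
theorem exists_shimuraKernelHom {W₁ : WeierstrassCurve ℚ} [W₁.IsElliptic] (D₁ : Gamma1ParametrizationData W₁ N)
    {f : CuspForm (Gamma0 N) 2} (hL : ∀ x, x ∈ D₁.L.lattice ↔ x ∈ periodLatticeGamma1 f)
    (hrat : ∀ z ∈ periodLattice f, ∃ P : (W₁.baseChange ℚ).toAffine.Point,
      Affine.Point.baseChange (W' := W₁) ℚ ℂ P = D₁.uniformize z) :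
    ∃ g : periodLattice f →+ (W₁.baseChange ℚ).toAffine.Point,
      (∀ z : periodLattice f, Affine.Point.baseChange (W' := W₁) ℚ ℂ (g z) = D₁.uniformize z) ∧
      g.ker = (periodLatticeGamma1 f).addSubgroupOf (periodLattice f) ∧
      ∀ z : periodLattice f, IsOfFinAddOrder (g z) := by
  classical
  have hinj : Function.Injective (Affine.Point.baseChange (W' := W₁) ℚ ℂ) :=
    Affine.Point.map_injective (W' := W₁) (Algebra.ofId ℚ ℂ)
  choose P hP using hrat
  set g₀ : periodLattice f → (W₁.baseChange ℚ).toAffine.Point := fun z ↦ P z.1 z.2 with hg₀def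
  have hg₀ : ∀ z : periodLattice f, Affine.Point.baseChange (W' := W₁) ℚ ℂ (g₀ z) = D₁.uniformize z := fun z ↦ hP z.1 z.2
  have hadd : ∀ a b : periodLattice f, g₀ (a + b) = g₀ a + g₀ b := fun a b ↦
    hinj (by rw [map_add, hg₀, hg₀, hg₀, AddSubgroup.coe_add, map_add])
  refine ⟨AddMonoidHom.mk' g₀ hadd, hg₀, ?_, fun z ↦ isOfFinAddOrder_of_baseChange_eq D₁ hL z.2 (hg₀ z)⟩
  ext z
  rw [AddMonoidHom.mem_ker, AddMonoidHom.mk'_apply, AddSubgroup.mem_addSubgroupOf,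
    ← uniformize_eq_zero_iff_of_latticeEq D₁ hL, ← hg₀ z, ← map_zero (Affine.Point.baseChange (W' := W₁) ℚ ℂ)]
  exact ⟨fun h ↦ by rw [h], fun h ↦ hinj h⟩

/-- **`[Λ₀(f) : Λ₁(f)] = #g(Λ₀(f))`** for any homomorphism on `Λ₀(f)` with kernel `Λ₁(f) ∩ Λ₀(f)` (first isomorphism theorem, `AddSubgroup.index_ker`).
[folklore] -/
theorem relIndex_eq_card_range {G : Type*} [AddCommGroup G] {Λ₀ Λ₁ : AddSubgroup ℂ} (g : Λ₀ →+ G)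
    (hker : g.ker = Λ₁.addSubgroupOf Λ₀) : Λ₁.relIndex Λ₀ = Nat.card g.range := by
  rw [AddSubgroup.relIndex, ← hker, AddSubgroup.index_ker]

/-- Cardinality of Mazur's fifteen groups: `#G_tors = n` resp. `4m`, and `G_tors` is finite. [cite: Mazur1977, Thm. (8)] -/
theorem card_torsion_of_mazurShape {G : Type*} [AddCommGroup G]
    (hM : (∃ n : ℕ, 1 ≤ n ∧ (n ≤ 10 ∨ n = 12) ∧ Nonempty (AddCommGroup.torsion G ≃+ ZMod n)) ∨
      (∃ m : ℕ, 1 ≤ m ∧ m ≤ 4 ∧ Nonempty (AddCommGroup.torsion G ≃+ ZMod 2 × ZMod (2 * m)))) :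
    Finite (AddCommGroup.torsion G) ∧
      ((1 ≤ Nat.card (AddCommGroup.torsion G) ∧ (Nat.card (AddCommGroup.torsion G) ≤ 10 ∨ Nat.card (AddCommGroup.torsion G) = 12)) ∨
        ∃ m : ℕ, 1 ≤ m ∧ m ≤ 4 ∧ Nat.card (AddCommGroup.torsion G) = 4 * m) := by
  rcases hM with ⟨n, hn, hn', ⟨e⟩⟩ | ⟨m, hm, hm4, ⟨e⟩⟩
  · haveI : NeZero n := ⟨by omega⟩
    have hcard : Nat.card (AddCommGroup.torsion G) = n := by rw [Nat.card_congr e.toEquiv, Nat.card_zmod]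
    exact ⟨Finite.of_equiv _ e.toEquiv.symm, Or.inl ⟨hcard ▸ hn, hcard ▸ hn'⟩⟩
  · haveI : NeZero (2 * m) := ⟨by omega⟩
    have hcard : Nat.card (AddCommGroup.torsion G) = 4 * m := by
      rw [Nat.card_congr e.toEquiv, Nat.card_prod, Nat.card_zmod, Nat.card_zmod]; ring
    exact ⟨Finite.of_equiv _ e.toEquiv.symm, Or.inr ⟨m, hm, hm4, hcard⟩⟩

/-- Divisors of `#G_tors` for Mazur's groups lie in `{1,…,10,12,16}`. [folklore] -/
theorem mazurDivisor_of_dvd {d t : ℕ} (hdt : d ∣ t)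
    (ht : (1 ≤ t ∧ (t ≤ 10 ∨ t = 12)) ∨ ∃ m : ℕ, 1 ≤ m ∧ m ≤ 4 ∧ t = 4 * m) :
    1 ≤ d ∧ (d ≤ 10 ∨ d = 12 ∨ d = 16) := by
  have ht0 : 0 < t := by rcases ht with ⟨h, -⟩ | ⟨m, hm, -, rfl⟩ <;> omega
  have hd : d ≤ t := Nat.le_of_dvd ht0 hdt
  have ht16 : t ≤ 16 := by rcases ht with ⟨-, h⟩ | ⟨m, -, hm, rfl⟩ <;> omega
  have hd0 : d ≠ 0 := by
    rintro rfl
    rw [zero_dvd_iff] at hdt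
    omega
  have hmod : t % d = 0 := Nat.mod_eq_zero_of_dvd hdt
  have ht' : t ≤ 10 ∨ t = 12 ∨ t = 16 := by rcases ht with ⟨-, h⟩ | ⟨m, hm1, hm, rfl⟩ <;> omega
  have hd16 : d ≤ 16 := hd.trans ht16
  interval_cases d <;> omega

/-! ## §2 ⟸ Mazur alone: `[Λ₀(f) : Λ₁(f)]` divides `#W₁(ℚ)_tors`, hence lies in `{1,…,10,12,16}` -/

/-- **`[Λ₀(f) : Λ₁(f)]` divides the order of the rational torsion of Stevens' twin (⟸ `mazur_torsion` for finiteness).**  For every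
`X₀(N)`-datum `D₀` there are an elliptic `W₁/ℚ` and an `X₁(N)`-datum `D₁` with `D₁.f = D₀.f`, `Λ(D₁.L) = Λ₁(f)`, such that
`[Λ₀(f) : Λ₁(f)] ∣ #W₁(ℚ)_tors` and `1 ≤ [Λ₀(f) : Λ₁(f)]`.  CONDITIONAL on `mazur_torsion`.
[cite: Mazur1977, Thm. (8)] [cite: Stevens1989, §2 (1.4), (2.8)] [cite: Vatsal2005, Rem. 1.8] -/
theorem relIndex_dvd_card_torsion_of_mazur (hMT : ∀ V : WeierstrassCurve ℚ, mazur_torsion V)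
    (W₀ : WeierstrassCurve ℚ) [W₀.IsElliptic] (D₀ : ModularParametrizationData W₀ N) :
    ∃ (W₁ : WeierstrassCurve ℚ) (_ : W₁.IsElliptic) (D₁ : Gamma1ParametrizationData W₁ N),
      D₁.f = D₀.f ∧ (∀ x, x ∈ D₁.L.lattice ↔ x ∈ periodLatticeGamma1 D₀.f) ∧
      (periodLatticeGamma1 D₀.f).relIndex (periodLattice D₀.f) ∣ Nat.card (AddCommGroup.torsion (W₁.baseChange ℚ).toAffine.Point) ∧
      1 ≤ (periodLatticeGamma1 D₀.f).relIndex (periodLattice D₀.f) := by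
  obtain ⟨W₁, hW₁, D₁, hf, hL, hrat⟩ := CuspValues.shimuraKernelRational W₀ D₀
  obtain ⟨g, -, hker, htor⟩ := exists_shimuraKernelHom D₁ hL hrat
  obtain ⟨hfin, -⟩ := card_torsion_of_mazurShape (hMT (W₁.baseChange ℚ))
  have hle : g.range ≤ AddCommGroup.torsion (W₁.baseChange ℚ).toAffine.Point := by
    rintro _ ⟨z, rfl⟩
    exact (AddCommGroup.mem_torsion _).mpr (htor z)
  haveI : Finite g.range := Finite.of_injective _ (AddSubgroup.inclusion_injective hle)
  refine ⟨W₁, hW₁, D₁, hf, hL, ?_, ?_⟩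
  · rw [relIndex_eq_card_range g hker]
    exact AddSubgroup.card_dvd_of_le hle
  · rw [relIndex_eq_card_range g hker]
    exact Nat.card_pos

/-- **`[Λ₀(f) : Λ₁(f)] ∈ {1,…,10,12,16}` (⟸ `mazur_torsion` ALONE; no modularity)** — the printed bound `#(E₀ ∩ Σ(N)) ≤ 16`, kernel-checked
modulo Mazur's theorem: `1 ≤ [Λ₀(f) : Λ₁(f)]` and `[Λ₀(f) : Λ₁(f)] ≤ 10 ∨ = 12 ∨ = 16`, for every `X₀(N)`-datum of an elliptic `W₀/ℚ`.
(With modularity the sibling `relIndex_mazurOrder_of_modularity` excludes `16`.) [cite: Mazur1977, Thm. (8)] [cite: Vatsal2005, Rem. 1.8] -/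
theorem relIndex_mazurDivisor_of_mazur (hMT : ∀ V : WeierstrassCurve ℚ, mazur_torsion V)
    (W₀ : WeierstrassCurve ℚ) [W₀.IsElliptic] (D₀ : ModularParametrizationData W₀ N) :
    1 ≤ (periodLatticeGamma1 D₀.f).relIndex (periodLattice D₀.f) ∧
      ((periodLatticeGamma1 D₀.f).relIndex (periodLattice D₀.f) ≤ 10 ∨
        (periodLatticeGamma1 D₀.f).relIndex (periodLattice D₀.f) = 12 ∨
        (periodLatticeGamma1 D₀.f).relIndex (periodLattice D₀.f) = 16) := by
  obtain ⟨W₁, hW₁, D₁, -, -, hdvd, -⟩ := relIndex_dvd_card_torsion_of_mazur hMT W₀ D₀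
  obtain ⟨-, ht⟩ := card_torsion_of_mazurShape (hMT (W₁.baseChange ℚ))
  exact mazurDivisor_of_dvd hdvd ht

/-- **`[Λ₀(f) : Λ₁(f)] ≤ 16`** (⟸ `mazur_torsion`). [cite: Mazur1977, Thm. (8)] -/
theorem relIndex_le_sixteen_of_mazur (hMT : ∀ V : WeierstrassCurve ℚ, mazur_torsion V)
    (W₀ : WeierstrassCurve ℚ) [W₀.IsElliptic] (D₀ : ModularParametrizationData W₀ N) :
    (periodLatticeGamma1 D₀.f).relIndex (periodLattice D₀.f) ≤ 16 := by
  obtain ⟨-, h⟩ := relIndex_mazurDivisor_of_mazur hMT W₀ D₀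
  omega

end Summit.BirchSwinnertonDyer.BirchSwinnertonDyer.Theorems.ManinLocalTwoThree.StevensCurve

end
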